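import Literature.AlgebraicGeometry.Frobenioids.Thm42iiGeneral
import Literature.AlgebraicGeometry.Frobenioids.PerfectionIsFrobenioid
import HarnessLib

/-!
# [FrdI] Theorem 4.2 (i)(ii)(iii) AS TYPED over bases of FSM-type — the hypothesis "`C_i^pf` is a
# Frobenioid" DISCHARGED by Proposition 3.2 (iii) (PROOFS)

Mochizuki, *The geometry of Frobenioids I: the general theory*, Kyushu J. Math. **62** (2008)
293–400, §4, Theorem 4.2 p. 77 (proof pp. 78–81, by passage to the perfections `C_i^pf`, Prop. 3.2 (iii))
[cite: MochizukiFrdI2008, Thm. 4.2 p.77].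

The cell's general Thm. 4.2 closers (`thm42i_of_isOfFSMType_of_perfection`,
`thm42ii_ofFunctor_of_isOfFSMType_of_perfection`, `thm42iii_ofFunctor_of_isOfFSMType_of_perfection`; files
`Thm42SubAssemblyIGeneral.lean`, `Thm42SubAssemblyIIandIII.lean`, `Thm42iiGeneral.lean`, seat abc-iut-w5-d162)
carry the standing named hypotheses `hPf_i : IsFrobenioid (Perfection.ops hF_i).toFunctor` ("`C_i^pf` is a
Frobenioid", Prop. 3.2 (iii)).  That proposition is now a theorem of the tree for Frobenioids of
Frobenius-isotropic type (`PreFrobenioid.Perfection.isFrobenioid`, `PerfectionIsFrobenioid.lean`, seats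
abc-iut-L1-d9 / L1-d1 / w5-d246), and the setting `Thm42Setting` of Thm. 4.2 makes `C_i` of isotropic, hence
Frobenius-isotropic, type.  Hence the three typed statements hold over bases of FSM-type with `Φ_i`
perf-factorial and NO hypothesis on the perfections: `thm42i_ofFunctor_of_isOfFSMType`,
`thm42ii_ofFunctor_of_isOfFSMType`, `thm42iii_ofFunctor_of_isOfFSMType`.
No new definitions; nothing here is specific to the abc programme.
-/

namespace Literature.AlgebraicGeometry.Frobenioids

namespace FrdI.T42

open CategoryTheory Opposite PreFrobenioidData PreFrobenioid.Perfection

universe w v v' u u'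

variable {D₁ : Type u} [Category.{v} D₁] {Φ₁ : D₁ᵒᵖ ⥤ CommMonCat.{w}} {C₁ : Type u'} [Category.{v'} C₁]
  {D₂ : Type u} [Category.{v} D₂] {Φ₂ : D₂ᵒᵖ ⥤ CommMonCat.{w}} {C₂ : Type u'} [Category.{v'} C₂]
  {F₁ : C₁ ⥤ ElemFrobenioid Φ₁} {F₂ : C₂ ⥤ ElemFrobenioid Φ₂} (Ψ : C₁ ≌ C₂)

/-- Under `Thm42Setting` the perfection `C₁^pf` is a Frobenioid (Prop. 3.2 (iii): `C₁` is of isotropic,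
hence Frobenius-isotropic, type). [cite: MochizukiFrdI2008, Prop. 3.2 (iii) p.59] -/
theorem isFrobenioid_ops_left (hF₁ : PreFrobenioid.IsFrobenioid F₁)
    (hT : Thm42Setting (ofFunctor Φ₁ F₁) (ofFunctor Φ₂ F₂)) : PreFrobenioid.IsFrobenioid (ops hF₁).toFunctor :=
  PreFrobenioid.Perfection.isFrobenioid hF₁ (isFrobeniusIsotropic_of_isOfIsotropicType hF₁ (of_thm42Setting hT).1)

/-- Under `Thm42Setting` the perfection `C₂^pf` is a Frobenioid (Prop. 3.2 (iii)).
[cite: MochizukiFrdI2008, Prop. 3.2 (iii) p.59] -/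
theorem isFrobenioid_ops_right (hF₂ : PreFrobenioid.IsFrobenioid F₂)
    (hT : Thm42Setting (ofFunctor Φ₁ F₁) (ofFunctor Φ₂ F₂)) : PreFrobenioid.IsFrobenioid (ops hF₂).toFunctor :=
  PreFrobenioid.Perfection.isFrobenioid hF₂ (isFrobeniusIsotropic_of_isOfIsotropicType hF₂ (of_thm42Setting hT).2.1)

/-- **Theorem 4.2 (i) AS TYPED (`PreFrobenioidData.Thm42i`)** for Frobenioids with `Φ_i` perf-factorial over
bases of FSM-type — the hypothesis "`C_i^pf` is a Frobenioid" of `thm42i_of_isOfFSMType_of_perfection`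
discharged by Prop. 3.2 (iii). [cite: MochizukiFrdI2008, Thm. 4.2 (i) p.77] -/
theorem thm42i_ofFunctor_of_isOfFSMType (hF₁ : PreFrobenioid.IsFrobenioid F₁) (hF₂ : PreFrobenioid.IsFrobenioid F₂)
    (hpf₁ : Objectwise (fun M _ => IsPerfFactorial M) Φ₁) (hpf₂ : Objectwise (fun M _ => IsPerfFactorial M) Φ₂)
    (hD₁ : IsOfFSMType D₁) (hD₂ : IsOfFSMType D₂) :
    (ofFunctor Φ₁ F₁).Thm42i (ofFunctor Φ₂ F₂) Ψ := fun hT =>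
  thm42i_of_isOfFSMType_of_perfection Ψ hF₁ hF₂ (isFrobenioid_ops_left hF₁ hT) (isFrobenioid_ops_right hF₂ hT)
    hpf₁ hpf₂ hD₁ hD₂ hT

/-- **Theorem 4.2 (ii) AS TYPED (`PreFrobenioidData.Thm42ii`)** for Frobenioids with `Φ_i` perf-factorial over
bases of FSM-type — the hypothesis "`C_i^pf` is a Frobenioid" of
`thm42ii_ofFunctor_of_isOfFSMType_of_perfection` discharged by Prop. 3.2 (iii).
[cite: MochizukiFrdI2008, Thm. 4.2 (ii) p.77] -/
theorem thm42ii_ofFunctor_of_isOfFSMType (hF₁ : PreFrobenioid.IsFrobenioid F₁)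
    (hF₂ : PreFrobenioid.IsFrobenioid F₂)
    (hpf₁ : Objectwise (fun M _ => IsPerfFactorial M) Φ₁) (hpf₂ : Objectwise (fun M _ => IsPerfFactorial M) Φ₂)
    (hD₁ : IsOfFSMType D₁) (hD₂ : IsOfFSMType D₂) :
    (ofFunctor Φ₁ F₁).Thm42ii (ofFunctor Φ₂ F₂) Ψ := fun hT =>
  thm42ii_ofFunctor_of_isOfFSMType_of_perfection Ψ hF₁ hF₂ (isFrobenioid_ops_left hF₁ hT)
    (isFrobenioid_ops_right hF₂ hT) hpf₁ hpf₂ hD₁ hD₂ hT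

/-- **Theorem 4.2 (iii) AS TYPED (`PreFrobenioidData.Thm42iii`)** for Frobenioids with `Φ_i` perf-factorial
over bases of FSM-type, for every family `e` satisfying the clauses of (ii) — the hypothesis "`C_i^pf` is a
Frobenioid" of `thm42iii_ofFunctor_of_isOfFSMType_of_perfection` discharged by Prop. 3.2 (iii).
[cite: MochizukiFrdI2008, Thm. 4.2 (iii) p.78] -/
theorem thm42iii_ofFunctor_of_isOfFSMType (hF₁ : PreFrobenioid.IsFrobenioid F₁)
    (hF₂ : PreFrobenioid.IsFrobenioid F₂)
    (hpf₁ : Objectwise (fun M _ => IsPerfFactorial M) Φ₁) (hpf₂ : Objectwise (fun M _ => IsPerfFactorial M) Φ₂)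
    (hD₁ : IsOfFSMType D₁) (hD₂ : IsOfFSMType D₂)
    (e : ∀ A : C₁, Primes (Φ₁.obj (op (PreFrobenioid.baseObj F₁ A))) ≃
      Primes (Φ₂.obj (op (PreFrobenioid.baseObj F₂ (Ψ.functor.obj A)))))
    (he : ∀ (A : C₁) (𝔭 : Primes (Φ₁.obj (op (PreFrobenioid.baseObj F₁ A)))),
      (∀ ⦃B : C₁⦄ (φ : A ⟶ B), PreFrobenioid.IsCoAngularPreStep F₁ φ →
          (PreFrobenioid.Div F₁ φ ∈ 𝔭.submonoid ↔
            PreFrobenioid.Div F₂ (Ψ.functor.map φ) ∈ (e A 𝔭).submonoid)) ∧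
        ∀ ⦃B : C₁⦄ (ψ : B ⟶ A), PreFrobenioid.IsCoAngularPreStep F₁ ψ →
          ((∃ y ∈ 𝔭.submonoid, Frobenioids.pull Φ₁ (PreFrobenioid.Base F₁ ψ) y = PreFrobenioid.Div F₁ ψ) ↔
            ∃ y ∈ (e A 𝔭).submonoid, Frobenioids.pull Φ₂ (PreFrobenioid.Base F₂ (Ψ.functor.map ψ)) y =
              PreFrobenioid.Div F₂ (Ψ.functor.map ψ))) :
    (ofFunctor Φ₁ F₁).Thm42iii (ofFunctor Φ₂ F₂) Ψ e := fun hT =>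
  thm42iii_ofFunctor_of_isOfFSMType_of_perfection Ψ hF₁ hF₂ (isFrobenioid_ops_left hF₁ hT)
    (isFrobenioid_ops_right hF₂ hT) hpf₁ hpf₂ hD₁ hD₂ e he hT

/-- **Theorem 4.2 (ii) and (iii) together**, over bases of FSM-type with `Φ_i` perf-factorial: THE unique family
of prime bijections of (ii) exists, and (iii) holds for it. [cite: MochizukiFrdI2008, Thm. 4.2 (iii) p.78] -/
theorem thm42ii_iii_ofFunctor_of_isOfFSMType (hF₁ : PreFrobenioid.IsFrobenioid F₁)
    (hF₂ : PreFrobenioid.IsFrobenioid F₂)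
    (hpf₁ : Objectwise (fun M _ => IsPerfFactorial M) Φ₁) (hpf₂ : Objectwise (fun M _ => IsPerfFactorial M) Φ₂)
    (hD₁ : IsOfFSMType D₁) (hD₂ : IsOfFSMType D₂) (hT : Thm42Setting (ofFunctor Φ₁ F₁) (ofFunctor Φ₂ F₂)) :
    ∃ e : ∀ A : C₁, Primes (Φ₁.obj (op (PreFrobenioid.baseObj F₁ A))) ≃
        Primes (Φ₂.obj (op (PreFrobenioid.baseObj F₂ (Ψ.functor.obj A)))),
      (ofFunctor Φ₁ F₁).Thm42iii (ofFunctor Φ₂ F₂) Ψ e := by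
  obtain ⟨e, he, -⟩ := thm42ii_ofFunctor_of_isOfFSMType Ψ hF₁ hF₂ hpf₁ hpf₂ hD₁ hD₂ hT
  have conv : ∀ ⦃A B : C₁⦄ (φ : A ⟶ B), PreFrobenioid.IsCoAngularPreStep F₁ φ →
      (ofFunctor Φ₁ F₁).IsCoAngularPreStep φ :=
    fun _ _ φ h => ⟨(ofFunctor_isCoAngular F₁ φ).mpr h.1, h.2⟩
  exact ⟨e, thm42iii_ofFunctor_of_isOfFSMType Ψ hF₁ hF₂ hpf₁ hpf₂ hD₁ hD₂ e fun A 𝔭 =>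
    ⟨fun B φ hφ => (he A 𝔭).1 φ (conv φ hφ), fun B ψ hψ => (he A 𝔭).2 ψ (conv ψ hψ)⟩⟩

end FrdI.T42

end Literature.AlgebraicGeometry.Frobenioids
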